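import Literature.MathematicalPhysics.QuantumFieldTheory.Balaban1983to89.Node00.CarriersZRegCubes

/-!
# NODE 00 — DEFINER B11, FILE 5: PRINT's CUBE CLASS ACROSS THE FAMILY OF RECORD — admissibility of the numerics `(R₁, M₁)` against the torus
# exponent `m`, the EXACT CENSUS of the «M ≦ M(ε₁)» range of (9)–(10), and print's size bound `M(ε₁) = R₁M₁(a₁∕ε₁) ≥ R₁M₁` as a displayed reading

Seat `pub-ymgap-node00-def-B11` (DEFINER B11; row R141 (A) of director-ym — THE ANSWER OF RECORD «`Node00/CarriersZ.lean` IS the [B11] carrier pin» (pub-ymgap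
INBOX l.12150) STANDS; this file, like FILES 1–4 (`Node00.CarriersZSectE`, `…CarriersZRegSound`, `…CarriersZRegPin`, `…CarriersZRegCubes`), REFINES the residual
layer and is never a second pin of `Residual₅.Z`).  [Balaban1985Variational] = T. Bałaban, *The variational problem and background fields in renormalization group
method for lattice gauge theories*, Commun. Math. Phys. 102 (1985) 277–309 ([B11]).

WHY.  FILE 4 (`Node00.CarriersZRegCubes`, p482542) typed print's cube class at NODE 00's member `⟨K, k⟩` and DISPLAYED its census PER MEMBER
(`B11CubeIdx.nonempty_iff : Nonempty (B11CubeIdx P k ν) ↔ 6R₁·LᵏM₁ ≤ P.sitesPerDir 0`), whence referee dag-ref-C's READER RULE (w6′) (READ-154): *«a N07 count line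
in `Reg910ClassT` currency must DISPLAY `6 * ν.R₁ * side (F.P i.K).L ν.M₁ i.k ≤ (F.P i.K).sitesPerDir 0` for each member it claims (or cite `nonempty_iff` with
it)»*, and referee dag-ref-G's remark (r1) (READ55): the size bound `B11Thm1.Consts.Mfun` of r2's `Thm1Printed` is unconstrained, so the range «M ≦ M(ε₁)» of the
regularity clause may be EMPTY.  THIS FILE gives both channels ONE CLOSED NAME ACROSS THE FAMILY: (w6′) holds at EVERY member `i : ZIdx` iff the numerics are
ADMISSIBLE for the family, `ν.FitsFamily F :⟺ 3R₁M₁ ≤ L^m` (`fitsFamily_iff_forall_display`; the binding member is the diagonal `k = K`, where `T⁽ᵏ⁾` is the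
physical torus of side `2L^m`), which print's smallest numerics meet on EVERY family of record HYPOTHESIS-FREE (`fitsFamily_one`: `3 ≤ 12 ≤ L ≤ L^m`); the
«M ≦ Mmax» range at a member is non-empty iff (w6′) ∧ `R₁M₁ ≤ Mmax` (`exists_sizeM_le_iff`, exact); and print's *«M(ε₁) = R₁M₁(a₁∕ε₁)»* (p. 279), read over r2's
`B11Thm1.Consts` as `ν.MfunPrinted C` ⟹ `ν.MfunLB C` («`M(ε₁) ≥ R₁M₁` on `(0, a₁]`»), makes the range NON-EMPTY AT EVERY MEMBER AND EVERY ADMISSIBLE `ε₁`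
(`exists_sizeM_le_Mfun`) — so a count line over the class cites one name for (w6′) ∧ (r1), and the (9)–(10) sentence then SAYS something: the ∃u-clause on the unit
cube (`reg910T_unitAtZero_of_reg910ClassT`).  The degenerate value is PROVED, not hidden: inadmissible numerics ⇒ the class is EMPTY at every diagonal member
and `Reg910ClassT` holds there VACUOUSLY for every `U` (`isEmpty_diag_of_not_fitsFamily`, `reg910ClassT_diag_of_not_fitsFamily`).

PRINT (p. 279, verbatim).  *«… for an arbitrary cube □ in the class described above, of a size 2MLʲη, M ≦ M(ε₁), there exists a gauge transformation u …
More exactly M(ε₁) = R₁M₁(a₁∕ε₁).»*  (p. 278: *«□ has a size 2MLʲη, where M is a multiple of R₁M₁, and … the cube □̃ of the size (2M + 4R₁M₁)Lʲη … is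
contained in B_j(Λ_j) ∪ B_{j+1}(Λ_{j+1})»*; [Balaban1987RG1] (0.1) p. 251: the torus `T_η` has `2L^{m+K−j}` sites per direction at level `j`, `m ≥ 1`, `L > 11`.)

WHAT (all definitions total; theorems kernel bookkeeping over FILE 4's objects — `ℕ`-arithmetic and one real division).
§1 `famP_sitesPerDir_zero`, `six_mul_side_eq`, ★ `B11CubeIdx.nonempty_iff_pow` (FILE 4's census in closed form: `3R₁M₁·Lᵏ ≤ L^{m+K}`).
§2 ★ `B11CubeNumerics.FitsFamily` + `fitsFamily_iff`, `nonempty_of_fitsFamily`, `fitsFamily_of_nonempty_diag`, ★ `fitsFamily_iff_forall_nonempty`,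
★ `fitsFamily_iff_forall_display` ((w6′) at every member in one line), ★ `fitsFamily_one` (hypothesis-free), `isEmpty_diag_of_not_fitsFamily`,
`reg910ClassT_diag_of_not_fitsFamily` (degenerate value displayed).
§3 ★ `exists_sizeM_le_iff` (exact census of the «M ≦ Mmax» range), `exists_sizeM_le_iff_of_fitsFamily`, ★ `reg910T_unitAtZero_of_reg910ClassT`.
§4 `B11CubeNumerics.MfunPrinted` (print's formula, verbatim), `B11CubeNumerics.MfunLB` (its weakest consequence closing (r1)), `mfunLB_of_mfunPrinted`,
`exists_mfunPrinted` (consistency with r2's `Consts`), ★★ `exists_sizeM_le_Mfun`, ★ `reg910T_unitAtZero_of_reg910ClassT_mfun`.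

WHAT NOT.  Nothing of [Balaban1985Variational] is asserted or proved (no minimal configurations, no regularity; r2's `B11Thm1.Consts` ∕ `Thm1Printed` UNTOUCHED —
`MfunPrinted` ∕ `MfunLB` are READINGS a consumer takes as hypotheses, offered to the literature lane as the displayed form of (r1)); FILE 3's ray `ρ` and the
numerics `ν = (R₁, M₁)` REMAIN displayed; print's «compatible partitions» divisibility side conditions are node00-def's admissibility conditions, NOT imposed; N07 is
NOT discharged; COUNT-NEUTRAL; one finite `T⁴` programme at fixed `ε = L^{−K}` — NOT continuum ∕ ℝ⁴ ∕ OS ∕ mass-gap ∕ Clay.  0 `sorry` ∕ `axiom` ∕ `instance` ∕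
`notation`; imports FILE 4 only; filed `--kind definition --supports stmt-QuantumFields-19902`.
-/

namespace Literature.MathematicalPhysics.QuantumFieldTheory.Balaban1983to89.Node00

open T4Continuum AveragingRT T4FiniteEpsInhabited FlowStep FlowStepRuns DagBinding T4DatumAssembly
open B14.Eq213MaximalDomains (side)
open B11Reg910Classes (Reg910T)

/-! ## §1. FILE 4's per-member census in closed form -/

section Member

variable (F : T4Family) (K k : ℕ) (ν : B11CubeNumerics)

/-- The finest torus of the `K`-th approximation has `2L^{m+K}` sites per direction. [cite: Balaban1987RG1, (0.1) p.251 (bookkeeping)] -/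
theorem famP_sitesPerDir_zero : (F.P K).sitesPerDir 0 = 2 * F.L ^ (F.m + K) := rfl

/-- The side of a multiplicity-`1` enlarged cube □̃ in fine sites, `6R₁·LᵏM₁ = 2·(3R₁M₁·Lᵏ)`. [cite: Balaban1985Variational, p.278 («(2M + 4R₁M₁)Lʲη»; bookkeeping)] -/
theorem six_mul_side_eq : 6 * ν.R₁ * side (F.P K).L ν.M₁ k = 2 * (3 * ν.R₁ * ν.M₁ * F.L ^ k) := by
  show 6 * ν.R₁ * (F.L ^ k * ν.M₁) = 2 * (3 * ν.R₁ * ν.M₁ * F.L ^ k)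
  ring

/-- ★ **FILE 4's CENSUS IN CLOSED FORM**: the class at member `⟨K, k⟩` is inhabited iff `3R₁M₁·Lᵏ ≤ L^{m+K}` (i.e. `6R₁·LᵏM₁ ≤ 2L^{m+K}` fine sites: one □̃ of
multiplicity `1` does not wrap). [cite: Balaban1985Variational, pp.278–279 (reading D-defB11-5-1; bookkeeping)] -/
theorem B11CubeIdx.nonempty_iff_pow : Nonempty (B11CubeIdx (F.P K) k ν) ↔ 3 * ν.R₁ * ν.M₁ * F.L ^ k ≤ F.L ^ (F.m + K) := by
  rw [B11CubeIdx.nonempty_iff, six_mul_side_eq, famP_sitesPerDir_zero]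
  exact ⟨fun h => Nat.le_of_mul_le_mul_left h (by norm_num), fun h => Nat.mul_le_mul_left 2 h⟩

end Member

/-! ## §2. Admissibility of the numerics for the FAMILY of record -/

/-- ★ **THE NUMERICS `(R₁, M₁)` ARE ADMISSIBLE FOR THE FAMILY `F`**: `3R₁M₁ ≤ L^m`, i.e. the physical torus — `2L^m` sites per direction in `T⁽ᵏ⁾`-units at EVERY
member `⟨K, k⟩` when `k = K` — holds one enlarged cube □̃ of multiplicity `1` (side `6R₁M₁` in `T⁽ᵏ⁾`-units, `6R₁M₁ ≤ 2L^m`).  Equivalent to «print's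
class is inhabited at every member» (`fitsFamily_iff_forall_nonempty`). [cite: Balaban1985Variational, pp.278–279 («We consider all cubes □ satisfying the above conditions»)] -/
def B11CubeNumerics.FitsFamily (ν : B11CubeNumerics) (F : T4Family) : Prop :=
  3 * ν.R₁ * ν.M₁ ≤ F.L ^ F.m

section Family

variable {F : T4Family} {ν : B11CubeNumerics}

/-- Unfolding (`Iff.rfl`; a closed `ℕ`-inequality, decidable on numerals by `decide` after `unfold`). [cite: Balaban1985Variational, p.279 (bookkeeping)] -/
theorem B11CubeNumerics.fitsFamily_iff : ν.FitsFamily F ↔ 3 * ν.R₁ * ν.M₁ ≤ F.L ^ F.m :=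
  Iff.rfl

/-- Admissible numerics ⇒ the class is inhabited at every member `k ≤ K`. [cite: Balaban1985Variational, p.279 (bookkeeping)] -/
theorem nonempty_of_fitsFamily (h : ν.FitsFamily F) {K k : ℕ} (hk : k ≤ K) : Nonempty (B11CubeIdx (F.P K) k ν) := by
  have hL : 0 < F.L := lt_trans Nat.zero_lt_one F.hL.2
  rw [B11CubeIdx.nonempty_iff_pow]
  calc 3 * ν.R₁ * ν.M₁ * F.L ^ k ≤ F.L ^ F.m * F.L ^ k := Nat.mul_le_mul_right _ h
    _ ≤ F.L ^ F.m * F.L ^ K := Nat.mul_le_mul_left _ (Nat.pow_le_pow_right hL hk)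
    _ = F.L ^ (F.m + K) := (pow_add _ _ _).symm

/-- The diagonal member `⟨K, K⟩` is the binding one: a cube of the class there forces admissibility. [cite: Balaban1985Variational, p.279 (bookkeeping)] -/
theorem fitsFamily_of_nonempty_diag {K : ℕ} (h : Nonempty (B11CubeIdx (F.P K) K ν)) : ν.FitsFamily F := by
  have hL : 0 < F.L := lt_trans Nat.zero_lt_one F.hL.2
  rw [B11CubeIdx.nonempty_iff_pow, pow_add] at h
  exact Nat.le_of_mul_le_mul_right h (pow_pos hL K)

/-- ★ **ADMISSIBILITY = THE CLASS IS INHABITED AT EVERY MEMBER OF THE LAYER INDEX.** [cite: Balaban1985Variational, pp.278–279] -/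
theorem fitsFamily_iff_forall_nonempty : ν.FitsFamily F ↔ ∀ i : ZIdx, Nonempty (B11CubeIdx (F.P i.K) i.k ν) :=
  ⟨fun h i => nonempty_of_fitsFamily h i.hk, fun h => fitsFamily_of_nonempty_diag (h ⟨0, 0, le_rfl⟩)⟩

/-- ★ **READER RULE (w6′) AT EVERY MEMBER IN ONE CLOSED LINE**: `3R₁M₁ ≤ L^m` iff `6 * ν.R₁ * side (F.P i.K).L ν.M₁ i.k ≤ (F.P i.K).sitesPerDir 0` for every
`i : ZIdx`. [cite: Balaban1985Variational, pp.278–279 (bookkeeping)] -/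
theorem fitsFamily_iff_forall_display : ν.FitsFamily F ↔ ∀ i : ZIdx, 6 * ν.R₁ * side (F.P i.K).L ν.M₁ i.k ≤ (F.P i.K).sitesPerDir 0 :=
  fitsFamily_iff_forall_nonempty.trans (forall_congr' fun i => B11CubeIdx.nonempty_iff (F.P i.K) i.k ν)

/-- ★ **PRINT's SMALLEST NUMERICS ARE ADMISSIBLE ON EVERY FAMILY OF RECORD, HYPOTHESIS-FREE** (`3 ≤ 12 ≤ L ≤ L^m` from `L > 11`, `m ≥ 1`): the admissible set is
never empty. [cite: Balaban1985Variational, p.277; Balaban1987RG1, §0 p.251 («L … > 11», «m is a positive integer»)] -/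
theorem fitsFamily_one (F : T4Family) : B11CubeNumerics.one.FitsFamily F := by
  have hL : 0 < F.L := lt_trans Nat.zero_lt_one F.hL.2
  have h11 := F.hL11
  show 3 * 1 * 1 ≤ F.L ^ F.m
  calc 3 * 1 * 1 ≤ F.L := by omega
    _ = F.L ^ 1 := (pow_one _).symm
    _ ≤ F.L ^ F.m := Nat.pow_le_pow_right hL F.hm

/-- **THE DEGENERATE VALUE, PROVED**: inadmissible numerics ⇒ the class is EMPTY at every diagonal member `⟨K, K⟩`. [cite: Balaban1985Variational, p.279 (bookkeeping)] -/
theorem isEmpty_diag_of_not_fitsFamily (h : ¬ ν.FitsFamily F) (K : ℕ) : IsEmpty (B11CubeIdx (F.P K) K ν) :=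
  not_nonempty_iff.1 fun hne => h (fitsFamily_of_nonempty_diag hne)

variable {N : ℕ} [NeZero N]

/-- … and then the (9)–(10) sentence over the class holds VACUOUSLY at every diagonal member, for EVERY configuration and all thresholds — displayed so that no
count line reads content into it. [cite: Balaban1985Variational, Thm 1 (9)–(10) p.279 (bookkeeping)] -/
theorem reg910ClassT_diag_of_not_fitsFamily (h : ¬ ν.FitsFamily F) (K : ℕ) (B₃ B₄ ε₁ Mmax : ℝ) (U : GaugeField (F.P K) 0 (SU N)) :
    Reg910ClassT F N K K ν B₃ B₄ ε₁ Mmax U :=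
  fun q => ((isEmpty_diag_of_not_fitsFamily h K).false q).elim

end Family

/-! ## §3. The exact census of the «M ≦ Mmax» range of (9)–(10) -/

section Range

variable {F : T4Family} {K k : ℕ}

/-- ★ **EXACT CENSUS OF THE RANGE OF THE REGULARITY CLAUSE** at member `⟨K, k⟩`: some cube of record has `M = n·R₁M₁ ≤ Mmax` iff the class is inhabited ((w6′))
AND `R₁M₁ ≤ Mmax` ((r1)) — the multiplicity-`1` cubes are the smallest. [cite: Balaban1985Variational, Thm 1 p.279 («M ≦ M(ε₁)», «M is a multiple of R₁M₁»)] -/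
theorem exists_sizeM_le_iff (ν : B11CubeNumerics) (Mmax : ℝ) :
    (∃ q : B11CubeIdx (F.P K) k ν, (cubesOfRecordT F K k ν).sizeM q ≤ Mmax) ↔
      6 * ν.R₁ * side (F.P K).L ν.M₁ k ≤ (F.P K).sitesPerDir 0 ∧ ((ν.R₁ * ν.M₁ : ℕ) : ℝ) ≤ Mmax := by
  constructor
  · rintro ⟨q, hq⟩
    refine ⟨q.six_mul_le_sitesPerDir, le_trans ?_ hq⟩
    rw [cubesOfRecordT_sizeM]
    have hn : ν.R₁ * ν.M₁ ≤ q.n * ν.R₁ * ν.M₁ := by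
      calc ν.R₁ * ν.M₁ = 1 * ν.R₁ * ν.M₁ := by rw [one_mul]
        _ ≤ q.n * ν.R₁ * ν.M₁ := Nat.mul_le_mul_right _ (Nat.mul_le_mul_right _ q.one_le_n)
    exact_mod_cast hn
  · rintro ⟨h, hM⟩
    exact exists_sizeM_le h hM

/-- At admissible numerics the range census at every member reduces to `R₁M₁ ≤ Mmax`. [cite: Balaban1985Variational, Thm 1 p.279 (bookkeeping)] -/
theorem exists_sizeM_le_iff_of_fitsFamily {ν : B11CubeNumerics} (h : ν.FitsFamily F) (i : ZIdx) (Mmax : ℝ) :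
    (∃ q : (cubesOfRecordZ F ν i).Q, (cubesOfRecordZ F ν i).sizeM q ≤ Mmax) ↔ ((ν.R₁ * ν.M₁ : ℕ) : ℝ) ≤ Mmax := by
  show (∃ q : B11CubeIdx (F.P i.K) i.k ν, (cubesOfRecordT F i.K i.k ν).sizeM q ≤ Mmax) ↔ _
  rw [exists_sizeM_le_iff]
  exact and_iff_right ((B11CubeIdx.nonempty_iff (F.P i.K) i.k ν).1 (nonempty_of_fitsFamily h i.hk))

variable {N : ℕ} [NeZero N]

/-- ★ **THE SENTENCE SAYS SOMETHING**: if the (9)–(10) sentence over the class holds for `U` with size bound `Mmax ≥ R₁M₁` on a torus holding one □̃ of multiplicity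
`1`, then the ∃u-clause of (9)–(10) HOLDS for `U` on the unit cube at the zero corner, at thresholds `B₃R₁M₁ε₁`, `B₄R₁M₁ε₁`.
[cite: Balaban1985Variational, Thm 1 (9)–(10) p.279] -/
theorem reg910T_unitAtZero_of_reg910ClassT {ν : B11CubeNumerics} {B₃ B₄ ε₁ Mmax : ℝ} {U : GaugeField (F.P K) 0 (SU N)}
    (h910 : Reg910ClassT F N K k ν B₃ B₄ ε₁ Mmax U) (h : 6 * ν.R₁ * side (F.P K).L ν.M₁ k ≤ (F.P K).sitesPerDir 0)
    (hM : ((ν.R₁ * ν.M₁ : ℕ) : ℝ) ≤ Mmax) :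
    Reg910T F N K k U (B11CubeIdx.unitAtZero (F.P K) k ν h).carrierT k (fun x y => (F.P K).eta k * (Site.tdist x y : ℝ))
      (B₃ * ((ν.R₁ * ν.M₁ : ℕ) : ℝ) * ε₁) (B₄ * ((ν.R₁ * ν.M₁ : ℕ) : ℝ) * ε₁) 1 := by
  have hn : (B11CubeIdx.unitAtZero (F.P K) k ν h).n * ν.R₁ * ν.M₁ = ν.R₁ * ν.M₁ := by
    rw [B11CubeIdx.unitAtZero_n, one_mul]
  have h₁ := h910 (B11CubeIdx.unitAtZero (F.P K) k ν h)
  rw [hn] at h₁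
  exact h₁ hM

end Range

/-! ## §4. Print's size bound «M(ε₁) = R₁M₁(a₁∕ε₁)» as a displayed reading over r2's `B11Thm1.Consts` -/

/-- **PRINT's SIZE BOUND, VERBATIM** (p. 279 «More exactly M(ε₁) = R₁M₁(a₁∕ε₁)»), read over r2's constants structure: `C.Mfun ε₁ = R₁M₁·(a₁∕ε₁)` for `ε₁ > 0`.
A READING a consumer takes as a hypothesis (r2's `B11Thm1.Consts.Mfun` is unconstrained — referee remark (r1)); nothing asserted. [cite: Balaban1985Variational, Thm 1 p.279] -/
def B11CubeNumerics.MfunPrinted (ν : B11CubeNumerics) (C : B11Thm1.Consts) : Prop :=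
  ∀ ε₁ : ℝ, 0 < ε₁ → C.Mfun ε₁ = ((ν.R₁ * ν.M₁ : ℕ) : ℝ) * (C.a₁ / ε₁)

/-- **THE WEAKEST CONSEQUENCE THAT CLOSES THE EMPTY-RANGE CHANNEL (r1)**: `M(ε₁) ≥ R₁M₁` on `(0, a₁]` — the multiplicity-`1` cubes are always within the size
bound. [cite: Balaban1985Variational, Thm 1 p.279 («M ≦ M(ε₁)», «M(ε₁) = R₁M₁(a₁∕ε₁)»)] -/
def B11CubeNumerics.MfunLB (ν : B11CubeNumerics) (C : B11Thm1.Consts) : Prop :=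
  ∀ ε₁ : ℝ, 0 < ε₁ → ε₁ ≤ C.a₁ → ((ν.R₁ * ν.M₁ : ℕ) : ℝ) ≤ C.Mfun ε₁

section Mfun

variable {F : T4Family} {ν : B11CubeNumerics} {C : B11Thm1.Consts}

/-- Print's formula gives the lower bound (`a₁∕ε₁ ≥ 1` for `0 < ε₁ ≤ a₁`). [cite: Balaban1985Variational, Thm 1 p.279 (bookkeeping)] -/
theorem B11CubeNumerics.mfunLB_of_mfunPrinted (h : ν.MfunPrinted C) : ν.MfunLB C := fun ε₁ hε ha => by
  rw [h ε₁ hε]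
  have h1 : (1 : ℝ) ≤ C.a₁ / ε₁ := by rwa [le_div_iff₀ hε, one_mul]
  exact le_mul_of_one_le_right (Nat.cast_nonneg _) h1

/-- Consistency of the reading with r2's structure: constants with print's `M(ε₁)` exist (`a₀ = a₁ = B₃ = B₄ = 1`). [cite: Balaban1985Variational, Thm 1 p.279 (bookkeeping)] -/
theorem B11CubeNumerics.exists_mfunPrinted (ν : B11CubeNumerics) : ∃ C : B11Thm1.Consts, ν.MfunPrinted C :=
  ⟨{ a₀ := 1, a₁ := 1, B₃ := 1, B₄ := 1, Mfun := fun e => ((ν.R₁ * ν.M₁ : ℕ) : ℝ) * (1 / e),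
     a₀_pos := one_pos, a₁_pos := one_pos, B₃_pos := one_pos, B₄_pos := one_pos, B₃a₁_le := by norm_num,
     Mfun_pos := fun e he => mul_pos (by exact_mod_cast Nat.mul_pos ν.R₁_pos ν.M₁_pos) (one_div_pos.2 he) },
    fun _ _ => rfl⟩

/-- ★★ **AT PRINT's `M(ε₁)` THE RANGE OF (9)–(10) IS NON-EMPTY AT EVERY MEMBER AND EVERY ADMISSIBLE `ε₁`** — admissible numerics ((w6′) at every member) and
`M(ε₁) ≥ R₁M₁` ((r1)) in ONE name for a count line over the class. [cite: Balaban1985Variational, Thm 1 p.279] -/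
theorem exists_sizeM_le_Mfun (hF : ν.FitsFamily F) (hC : ν.MfunLB C) (i : ZIdx) {ε₁ : ℝ} (hε : 0 < ε₁) (ha : ε₁ ≤ C.a₁) :
    ∃ q : (cubesOfRecordZ F ν i).Q, (cubesOfRecordZ F ν i).sizeM q ≤ C.Mfun ε₁ :=
  (exists_sizeM_le_iff_of_fitsFamily hF i _).2 (hC ε₁ hε ha)

variable {N : ℕ} [NeZero N]

/-- ★ **THE (9)–(10) SENTENCE AT PRINT's SIZE BOUND SAYS SOMETHING AT EVERY MEMBER**: with admissible numerics and `M(ε₁) ≥ R₁M₁`, `Reg910ClassT` at `Mmax = M(ε₁)`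
for `U` yields the ∃u-clause for `U` on the unit cube of the member. [cite: Balaban1985Variational, Thm 1 (9)–(10) p.279] -/
theorem reg910T_unitAtZero_of_reg910ClassT_mfun (hF : ν.FitsFamily F) (hC : ν.MfunLB C) (i : ZIdx) {B₃ B₄ ε₁ : ℝ} (hε : 0 < ε₁) (ha : ε₁ ≤ C.a₁)
    {U : GaugeField (F.P i.K) 0 (SU N)} (h910 : Reg910ClassT F N i.K i.k ν B₃ B₄ ε₁ (C.Mfun ε₁) U) :
    Reg910T F N i.K i.k U (B11CubeIdx.unitAtZero (F.P i.K) i.k ν (fitsFamily_iff_forall_display.1 hF i)).carrierT i.k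
      (fun x y => (F.P i.K).eta i.k * (Site.tdist x y : ℝ)) (B₃ * ((ν.R₁ * ν.M₁ : ℕ) : ℝ) * ε₁) (B₄ * ((ν.R₁ * ν.M₁ : ℕ) : ℝ) * ε₁) 1 :=
  reg910T_unitAtZero_of_reg910ClassT h910 _ (hC ε₁ hε ha)

end Mfun

end Literature.MathematicalPhysics.QuantumFieldTheory.Balaban1983to89.Node00
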